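/-
Copyright (c) 2026 the pub-hodgecm-mathlib formalisation cell (harness21).  Prover seat hodgecm-mathlib-K2Liu-p09 (g0): Track B «K2-LIT»,
#184♮ = hLiu418 = stmt-HodgeConjecture-24832, file #9 of the K2_Liu road (socket module
`Cruxes/HLiu418/Lines/K2_Liu_CurveThetaSigs_U3a_SiegelEisenstein.lean`), organ (III-b) step (b1); 2026-09-03.
-/
import Literature.NumberTheory.GelbartRogawski1991.DoubledUnitaryGlobalSplittingData   -- ★ `GRConstruction.HA`, `ratH`
import Literature.NumberTheory.Automorphic.UnitaryGroupRationalDiscrete                -- ★ `finite_range_inter_of_isCompact`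
import Mathlib.Data.Set.Card
import HarnessLib

/-!
# Crux `HLiu418`, Track B road `K2_Liu`, unit U3a «SIEGEL EISENSTEIN SERIES», file #9 — helper 5 (organ (III-b), step (b1) «BOUNDED
# MULTIPLICITY»): a translate `x · C` of a compact set meets `H(L⁺)` in at most `#(H(L⁺) ∩ C C⁻¹)` points, uniformly in `x ∈ H(𝔸)`

Cell `hodgecm-mathlib`, crux item hLiu418 = `stmt-HodgeConjecture-24832`, route of record `HCCMUnconditional`; squad K2 ∕ K2Liu,
prover K2Liu-p09 (g0).  THEOREMS ONLY (no `def`, no instance, no notation, no named-fact hypothesis, no `sorry`); lane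
`--supports stmt-HodgeConjecture-24832` (count-neutral helper toward socket #9 `sig_K2LiuSiegelEisensteinDoubledSummable`).

Step (b1) of Godement's count ([Garrett2018, §3.10, proof of Cor. 3.10.2]: «shrinking `C` sufficiently so that `γ · C ∩ C ≠ ∅` implies
`γ = 1` … `∫_C Σ_γ φ(γ g) dg = ∫_{P_k\G_k · C} φ`»; we keep `C` arbitrary and carry the multiplicity instead): for the doubled group
`H(𝔸) = U(𝕍 ⊕ −𝕍)(𝔸)` (★ `GRConstruction.HA`) and its rational points `H(L⁺)` (★ `ratH`, DISCRETE and meeting compacta finitely: ★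
`UnitaryGroup.finite_range_inter_of_isCompact`):

* `finite_ratH_inter_mul` — `H(L⁺) ∩ x·C` is finite for compact `C` and every `x`;
* **`exists_ncard_ratH_inter_mul_le`** — there is `m` (namely `#(H(L⁺) ∩ C·C⁻¹)`) with `#(H(L⁺) ∩ x·C) ≤ m` for ALL `x ∈ H(𝔸)`
  (`γ₁, γ₂ ∈ x C ⟹ γ₂ γ₁⁻¹`… we use `γ ↦ γ γ₁⁻¹ ∈ C C⁻¹`-free form `γ₁⁻¹ γ ∈ C⁻¹ C`; injection into `H(L⁺) ∩ C⁻¹ C`).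

This is the constant `m` in the unfolding inequality `Σ_{γ ∈ P_Δ(L⁺)\H(L⁺)} ∫_{hC} ψ(γ x) dx ≤ m · ∫_{P_Δ(L⁺)\H(L⁺) h C} ψ`.

HONEST LABEL.  Count-neutral helper of the K2_Liu road; it retires nothing by itself: `HC_CM` is proved only modulo the 7 printed
citations (2 remaining named inputs: hLiu418 = `stmt-HodgeConjecture-24832`, h413 = `stmt-HodgeConjecture-24833`) until rung 0 closes.

## References
* [Garrett2018] P. Garrett, *Modern Analysis of Automorphic Forms by Example* (2018), §3.10 (proof of Cor. 3.10.2).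
* [Borel1963] A. Borel, *Some finiteness properties of adele groups over number fields*, Publ. Math. IHÉS 16 (1963), §1.2.
* [Liu2021] Y. Liu, Camb. J. Math. 9 (2021), App. B §B.3 p. 101, Lem. B.10 (2).
-/

set_option autoImplicit false
-- the mandated namespace repeats the single-problem summit's segment (`HodgeConjecture.HodgeConjecture`)
set_option linter.dupNamespace false

noncomputable section

open scoped Matrix Pointwise
open NumberField IsDedekindDomain

namespace Summit.HodgeConjecture.HodgeConjecture.Cruxes.HLiu418.K2LiuSiegelDoubledRationalMultiplicity

open Literature.NumberTheory.Automorphic Literature.NumberTheory.Automorphic.UnitaryGroup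
open Literature.NumberTheory.GelbartRogawski1991 Literature.NumberTheory.GelbartRogawski1991.GRConstruction

variable (L : Type) [Field L] [NumberField L] [IsCMField L]
variable {N M n : ℕ} (e : Fin N × Fin M ≃ Fin n)
  (dV : Fin N → L) (hdV : ∀ i, IsCMField.complexConj L (dV i) = dV i)
  (dW : Fin M → L) (hdW : ∀ i, IsCMField.complexConj L (dW i) = dW i)

/-- `H(L⁺)` meets every compact subset of `H(𝔸)` in a finite set (★ `UnitaryGroup.finite_range_inter_of_isCompact`).
[cite: Borel1963, §1.2] -/
theorem finite_ratH_inter {C : Set (HA L e dV hdV dW hdW)} (hC : IsCompact C) :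
    (((ratH L e dV hdV dW hdW) : Set (HA L e dV hdV dW hdW)) ∩ C).Finite :=
  finite_range_inter_of_isCompact (Fp L) L (IsCMField.complexConj L) (n + n) (hermD L e dV hdV dW hdW) hC

/-- `H(L⁺) ∩ x·C` is finite for compact `C`. [cite: Borel1963, §1.2] -/
theorem finite_ratH_inter_mul {C : Set (HA L e dV hdV dW hdW)} (hC : IsCompact C) (x : HA L e dV hdV dW hdW) :
    (((ratH L e dV hdV dW hdW) : Set (HA L e dV hdV dW hdW)) ∩ x • C).Finite :=
  finite_ratH_inter L e dV hdV dW hdW (hC.smul x)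

/-- **BOUNDED MULTIPLICITY**: for compact `C ⊆ H(𝔸)` there is `m` with `#(H(L⁺) ∩ x·C) ≤ m` for every `x ∈ H(𝔸)` — if `γ₁ ∈ x C` then
`γ ↦ γ₁⁻¹ γ` injects `H(L⁺) ∩ x C` into `H(L⁺) ∩ C⁻¹ C`. [cite: Garrett2018, §3.10 (proof of Cor. 3.10.2)] [cite: Borel1963, §1.2] -/
theorem exists_ncard_ratH_inter_mul_le {C : Set (HA L e dV hdV dW hdW)} (hC : IsCompact C) :
    ∃ m : ℕ, ∀ x : HA L e dV hdV dW hdW, (((ratH L e dV hdV dW hdW) : Set (HA L e dV hdV dW hdW)) ∩ x • C).ncard ≤ m := by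
  have hCC : IsCompact (C⁻¹ * C) := hC.inv.mul hC
  have hfin : (((ratH L e dV hdV dW hdW) : Set (HA L e dV hdV dW hdW)) ∩ (C⁻¹ * C)).Finite :=
    finite_ratH_inter L e dV hdV dW hdW hCC
  refine ⟨(((ratH L e dV hdV dW hdW) : Set (HA L e dV hdV dW hdW)) ∩ (C⁻¹ * C)).ncard, fun x => ?_⟩
  rcases (((ratH L e dV hdV dW hdW) : Set (HA L e dV hdV dW hdW)) ∩ x • C).eq_empty_or_nonempty with h0 | ⟨γ₁, hγ₁, hγ₁C⟩
  · rw [h0, Set.ncard_empty]; exact Nat.zero_le _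
  · -- inject by `γ ↦ γ₁⁻¹ γ`
    refine Set.ncard_le_ncard_of_injOn (fun γ => γ₁⁻¹ * γ) (fun γ hγ => ?_) (fun a _ b _ hab => mul_left_cancel hab) hfin
    obtain ⟨hγ, hγC⟩ := hγ
    refine ⟨Subgroup.mul_mem _ (Subgroup.inv_mem _ hγ₁) hγ, ?_⟩
    obtain ⟨c₁, hc₁, rfl⟩ := hγ₁C
    obtain ⟨c, hc, rfl⟩ := hγC
    refine ⟨c₁⁻¹, Set.inv_mem_inv.2 hc₁, c, hc, ?_⟩
    simp only [smul_eq_mul, mul_inv_rev, mul_assoc, inv_mul_cancel_left]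

end Summit.HodgeConjecture.HodgeConjecture.Cruxes.HLiu418.K2LiuSiegelDoubledRationalMultiplicity

end
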